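import Summits.NavierStokesRegularity.NavierStokesRegularity.Theses.AdaptedFrequency
import Summits.NavierStokesRegularity.NavierStokesRegularity.Theses.RecurrentProfiles
import Summits.NavierStokesRegularity.NavierStokesRegularity.Theorems.AdaptedFrequencyAdaptedFrequencyConvergesOfMildHullRigidity
import Summits.NavierStokesRegularity.NavierStokesRegularity.Theorems.AdaptedFrequencyAdaptedFrequencyConvergesStubPinchedHullRecurrence
import Summits.NavierStokesRegularity.NavierStokesRegularity.Theorems.AdaptedFrequencyAdaptedFrequencyConvergesStubRecurrentPinchedBridge
import Literature.Analysis.FluidPDE.AdaptedBackwardKernel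
import Literature.Analysis.FluidPDE.TypeIAncientMild
import Literature.Analysis.FluidPDE.LocalTypeI
import Literature.Analysis.FluidPDE.SuitableWeak
import Literature.Analysis.FluidPDE.SelfSimilar
import HarnessLib

/-!
# Crux `AdaptedFrequencyConverges` (stmt-NavierStokesRegularity-10493), line `birkhoff-recurrent-hull`:
  the HULL-FORM certificate — the crux ⇐ `NoRecurrentPinchedPair` ⇐ `RecurrentLiouville` (stmt-1589)

Helper file (`--supports` the crux item; lead prover-line-stmt-NavierStokesRegularity-10493-c4-0, wave 1 integrated).

With the two hull-form stubs of the line LANDED —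
`stub_pinchedHullRecurrence` (p139254: Birkhoff recurrence on the pinched kernel-carrying mild hull: if a pinched
unit-viscosity Type-I ancient mild pair `(W, K)` exists then a UNIFORMLY RECURRENT one exists, recurrence of the
PAIR in `C⁰` on compact cylinders under the parabolic rescaling `(W,K) ↦ (nsRescale l W, l³K(l²·, l·))`) and
`stub_recurrentPinchedBridge` (p139191: such a recurrent pinched pair is a uniformly recurrent profile of
Albritton–Barker's local-energy Type-I class, singular at the origin) — the landed reduction
`adaptedFrequencyConverges_of_pinchedMildHullHStationary` (p119397) yields the sharpest recorded upper bound of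
the crux:

* `adaptedFrequencyConverges_of_noRecurrentPinchedPair` — **the crux follows from the non-existence of a
  uniformly recurrent pinched kernel-carrying pair** (`NoRecurrentPinchedPair`, the crux-specific Liouville
  statement S4⁺ of the strategist's census, inlined as the antecedent; its hypothesis class is a SUB-class of
  stmt-1589's: mild, pointwise Type-I, unique Gaussian-comparable adapted kernel, two-sided pinching, `C⁰`
  pair-recurrence);
* `noRecurrentPinchedPair_of_recurrentLiouville` — `NoRecurrentPinchedPair ⇐ RecurrentLiouville` (stmt-1589),
  by the bridge;
* composing the two is a second road to the landed certificate
  `BirkhoffRecurrentHull.adaptedFrequencyConverges_of_recurrentLiouville` (p137229, which goes through the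
  blow-up's own profile instead of the hull); it is not restated here (same type as the landed declaration).

So, kernel-checked: `crux ⇐ NoRecurrentPinchedPair ⇐ stmt-1589 ⇐ stmt-4050`, and a counterexample to the crux
is a BREATHER — a uniformly recurrent pinched kernel-carrying Type-I ancient mild pair (Bradshaw–Tsai OP 5.1 /
Tsai 2018 Conj. 8.8–8.9 objects; none is known).
-/

noncomputable section

-- the summit and its single problem share the name (D-0017 nested layout)
set_option linter.dupNamespace false

namespace Summit.NavierStokesRegularity.NavierStokesRegularity.Theorems.AdaptedFrequencyConverges.BirkhoffRecurrentHull

open scoped Topology ENNReal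
open Literature.Analysis.FluidPDE Set Filter MeasureTheory Function
open Summit.NavierStokesRegularity.NavierStokesRegularity.Theses

/-- **The crux ⇐ `NoRecurrentPinchedPair`.** If no unit-viscosity Type-I ancient mild field `W`
(`IsTypeIAncientMild C₀ W`) carries a Gaussian-comparable adapted backward kernel `K` on `(−∞,0)` with pole
`(0,0)`, unique among such kernels, with two-sided pinching `c ≤ (−τ)²·adaptedEnstrophy W K τ ≤ C'` (`0 < c`),
the PAIR `(W, K)` being uniformly recurrent in `C⁰` on compact cylinders under parabolic rescaling, then the
adapted frequency converges at every Type-I singular point (the crux). Proof: by p119397 it suffices that every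
pinched pair has constant `h̄`; given a pinched pair, Birkhoff recurrence on the hull (`stub_pinchedHullRecurrence`,
p139254) produces a uniformly recurrent pinched pair, which the hypothesis forbids — so the h-stationarity
hypothesis holds vacuously. [cite: Furstenberg1981, Thm 1.17; KochNadirashviliSereginSverak2009, Prop. 4.1] -/
theorem adaptedFrequencyConverges_of_noRecurrentPinchedPair :
    (∀ (C₀ c C' : ℝ) (W : ℝ → EuclideanSpace ℝ (Fin 3) → EuclideanSpace ℝ (Fin 3))
      (K : ℝ → EuclideanSpace ℝ (Fin 3) → ℝ), 0 ≤ C₀ → 0 < c → IsTypeIAncientMild C₀ W →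
      IsAdaptedBackwardKernel 1 W (Iio 0) 0 0 K → IsGaussianComparable K (Iio 0) 0 0 →
      (∀ K' : ℝ → EuclideanSpace ℝ (Fin 3) → ℝ, IsAdaptedBackwardKernel 1 W (Iio 0) 0 0 K' →
        IsGaussianComparable K' (Iio 0) 0 0 → ∀ t ∈ Iio (0:ℝ), K' t = K t) →
      (∀ τ ∈ Iio (0:ℝ), c ≤ (-τ) ^ 2 * adaptedEnstrophy W K τ ∧ (-τ) ^ 2 * adaptedEnstrophy W K τ ≤ C') →
      (∀ ε : ℝ, 0 < ε → ∀ R : ℝ, 1 < R → ∃ L : ℝ, 1 < L ∧ ∀ a : ℝ, 0 < a → ∃ l : ℝ, a ≤ l ∧ l ≤ L * a ∧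
        ∀ (t : ℝ) (x : EuclideanSpace ℝ (Fin 3)), -R ≤ t → t ≤ -R⁻¹ → ‖x‖ ≤ R →
          ‖nsRescale l W t x - W t x‖ ≤ ε ∧ |l ^ 3 * K (l ^ 2 * t) (l • x) - K t x| ≤ ε) → False) →
    Summit.NavierStokesRegularity.NavierStokesRegularity.Theses.AdaptedFrequency.AdaptedFrequencyConverges := by
  intro hno
  refine CloudFrameEffectiveTsai.adaptedFrequencyConverges_of_pinchedMildHullHStationary ?_
  intro C₀ c C' W K hC₀ hc hW hK hG huniq hpinch τ₁ τ₂ _ _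
  exfalso
  obtain ⟨C₀', c', C'', W', K', ⟨hC₀', hc', hW', hK', hG', huniq', hpinch'⟩, hrec⟩ :=
    stub_pinchedHullRecurrence ⟨C₀, c, C', W, K, hC₀, hc, hW, hK, hG, huniq, hpinch⟩
  exact hno C₀' c' C'' W' K' hC₀' hc' hW' hK' hG' huniq' hpinch' hrec

/-- **`NoRecurrentPinchedPair ⇐ RecurrentLiouville` (stmt-1589).** A uniformly recurrent pinched kernel-carrying
pair is, by the bridge `stub_recurrentPinchedBridge` (p139191: far-past energy AND gradient ledgers of the class
`A_C`, pressure package, `C⁰ ⇒ L³_loc` recurrence, singular origin by `RecurrentRegularIsTrivial` + pinching), a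
uniformly recurrent local-energy Type-I-rate profile that is backward-singular at the origin — exactly what the
recurrent Liouville theorem excludes. [cite: AlbrittonBarker2019, §1 and Rem. 3.2] -/
theorem noRecurrentPinchedPair_of_recurrentLiouville :
    Summit.NavierStokesRegularity.NavierStokesRegularity.Theses.RecurrentProfiles.RecurrentLiouville →
    (∀ (C₀ c C' : ℝ) (W : ℝ → EuclideanSpace ℝ (Fin 3) → EuclideanSpace ℝ (Fin 3))
      (K : ℝ → EuclideanSpace ℝ (Fin 3) → ℝ), 0 ≤ C₀ → 0 < c → IsTypeIAncientMild C₀ W →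
      IsAdaptedBackwardKernel 1 W (Iio 0) 0 0 K → IsGaussianComparable K (Iio 0) 0 0 →
      (∀ K' : ℝ → EuclideanSpace ℝ (Fin 3) → ℝ, IsAdaptedBackwardKernel 1 W (Iio 0) 0 0 K' →
        IsGaussianComparable K' (Iio 0) 0 0 → ∀ t ∈ Iio (0:ℝ), K' t = K t) →
      (∀ τ ∈ Iio (0:ℝ), c ≤ (-τ) ^ 2 * adaptedEnstrophy W K τ ∧ (-τ) ^ 2 * adaptedEnstrophy W K τ ≤ C') →
      (∀ ε : ℝ, 0 < ε → ∀ R : ℝ, 1 < R → ∃ L : ℝ, 1 < L ∧ ∀ a : ℝ, 0 < a → ∃ l : ℝ, a ≤ l ∧ l ≤ L * a ∧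
        ∀ (t : ℝ) (x : EuclideanSpace ℝ (Fin 3)), -R ≤ t → t ≤ -R⁻¹ → ‖x‖ ≤ R →
          ‖nsRescale l W t x - W t x‖ ≤ ε ∧ |l ^ 3 * K (l ^ 2 * t) (l • x) - K t x| ≤ ε) → False) := by
  intro hRL C₀ c C' W K hC₀ hc hW hK hG huniq hpinch hrec
  obtain ⟨p, G, C, hsw, hgr, hI, hdec, hL3, hsing⟩ :=
    stub_recurrentPinchedBridge C₀ c C' W K hC₀ hc hW hK hG huniq hpinch hrec
  exact hRL W p G C hsw hgr hI hdec hL3 hsing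

end Summit.NavierStokesRegularity.NavierStokesRegularity.Theorems.AdaptedFrequencyConverges.BirkhoffRecurrentHull

end
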